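/-
Width seat `ym-line-sgb-p1-w3` (gen 2, seat prover-ym-line-sgb-p1-w3-g2-0), route `SteinGapBootstrap` (rev ≥ 11), the GLUE item
`FreeProbeLawG_of_steinSplit` (stmt-QuantumFields-23801) of the split of U = `FreeProbeLawG` (stmt-QuantumFields-23756).
-/
import Summits.QuantumFields.YangMills.Theses.SteinGapBootstrap
import HarnessLib

/-!
# Route `SteinGapBootstrap`: the Stein seam `FreeProbeLawG_of_steinSplit` (stmt-QuantumFields-23801) — PROVED

NOT THE CLAY GAP: the route bears on the RECORD-label rung leaf R2ξ′ `WeakCouplingRates.XiPow`, an UPPER bound on the lattice mass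
gap of torus-limit states; this file is pure constants bookkeeping and proves no summit statement.

`FreeProbeLawG_of_steinSplit : PairSteinDiscrepancyFreeG → USteinTransferPair → UProbeCovFromPairLaw → FreeProbeLawG`:
the m-free approximate Gaussian Stein identity of the pair plaquette field (discrepancy `ε = C(1+n)^K β^{-δ}(1+M)` on `C²` test
functions with `M`-Lipschitz gradient), Stein's lemma for the lattice-Maxwell pair-block law (`USteinTransferPair`, alias of
`SteinTransferPairG`: discrepancy `ε(1+M)` ⇒ smooth-metric closeness `2ε` of the pair law to `γ_B`), and the probe covariance from
pair-law closeness under equipartition (`UProbeCovFromPairLaw`, alias of `ProbeCovFromPairLawG`: closeness `η` ⇒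
`|Cov_μ(P, P∘τ_n) − g_D(n)| ≤ C'η + C'β^{-δ'}`) compose to U = `FreeProbeLawG` with the constants
`K ↦ max K 0`, `δ ↦ min δ δ'`, `C ↦ 2CC' + C'`, `β₀ ↦ max (max β₀ β₀') 1` (so that `β ≥ 1`, `(1+n)^K ≤ (1+n)^{max K 0}` and
`β^{-δ}, β^{-δ'} ≤ β^{-min δ δ'}`).  The two aliases unfold by `rfl`.

References: the route thesis of `SteinGapBootstrap` (TWO-LAYER PLAN / split certificate of U); E. Meckes, IMS Coll. 5 (2009) 153,
Lemma 1–2 [Meckes2009]; S. Chatterjee, arXiv:1602.01222 [arXiv160201222].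
-/

set_option autoImplicit false

namespace Summit.QuantumFields.YangMills.Theorems.SteinGapBootstrap

open Summit.QuantumFields.YangMills.Theses.SteinGapBootstrap

/-- Constants bookkeeping: `2CC'(1+n)^K β^{-δ} + C' β^{-δ'} ≤ (2CC' + C')(1+n)^{max K 0} β^{-min δ δ'}` for `β ≥ 1`, `n ≥ 0`,
`C, C' > 0`. [folklore] -/
theorem glue_constants_le {K δ δ' C C' β : ℝ} {n : ℕ} (hC : 0 < C) (hC' : 0 < C') (hβ : 1 ≤ β) :
    C' * (2 * (C * (1 + (n : ℝ)) ^ K * β ^ (-δ))) + C' * β ^ (-δ') ≤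
      (2 * C * C' + C') * (1 + (n : ℝ)) ^ (max K 0) * β ^ (-(min δ δ')) := by
  have hn0 : (0 : ℝ) ≤ (n : ℝ) := by positivity
  have hx1 : (1 : ℝ) ≤ 1 + (n : ℝ) := by linarith
  have hβ0 : 0 < β := by linarith
  have h1 : (1 + (n : ℝ)) ^ K ≤ (1 + (n : ℝ)) ^ (max K 0) :=
    Real.rpow_le_rpow_of_exponent_le hx1 (le_max_left _ _)
  have h1' : (1 : ℝ) ≤ (1 + (n : ℝ)) ^ (max K 0) := Real.one_le_rpow hx1 (le_max_right _ _)
  have h2 : β ^ (-δ) ≤ β ^ (-(min δ δ')) :=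
    Real.rpow_le_rpow_of_exponent_le hβ (by simp)
  have h3 : β ^ (-δ') ≤ β ^ (-(min δ δ')) :=
    Real.rpow_le_rpow_of_exponent_le hβ (by simp)
  have hb : 0 ≤ β ^ (-(min δ δ')) := le_of_lt (Real.rpow_pos_of_pos hβ0 _)
  have hK0 : 0 ≤ (1 + (n : ℝ)) ^ K := le_of_lt (Real.rpow_pos_of_pos (by linarith) _)
  have hbδ : 0 ≤ β ^ (-δ) := le_of_lt (Real.rpow_pos_of_pos hβ0 _)
  have hA : C * (1 + (n : ℝ)) ^ K * β ^ (-δ) ≤ C * (1 + (n : ℝ)) ^ (max K 0) * β ^ (-(min δ δ')) :=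
    mul_le_mul (mul_le_mul_of_nonneg_left h1 hC.le) h2 hbδ (by positivity)
  have hB : β ^ (-δ') ≤ (1 + (n : ℝ)) ^ (max K 0) * β ^ (-(min δ δ')) :=
    le_trans h3 (le_mul_of_one_le_left hb h1')
  nlinarith [mul_le_mul_of_nonneg_left hA (by positivity : (0 : ℝ) ≤ 2 * C'),
    mul_le_mul_of_nonneg_left hB hC'.le]

/-- **The Stein seam of U (stmt-QuantumFields-23801), by name**:
`PairSteinDiscrepancyFreeG → USteinTransferPair → UProbeCovFromPairLaw → FreeProbeLawG` — the m-free Stein discrepancy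
`C(1+n)^K β^{-δ}(1+M)`, Stein's lemma for the lattice-Maxwell pair-block law (closeness `2ε`) and the probe covariance from pair-law
closeness (`C'η + C'β^{-δ'}`) compose with `K ↦ max K 0`, `δ ↦ min δ δ'`, `C ↦ 2CC' + C'`, `β₀ ↦ max (max β₀ β₀') 1`.
NOT THE CLAY GAP. -/
theorem freeProbeLawG_of_steinSplit_proof :
    Summit.QuantumFields.YangMills.Theses.SteinGapBootstrap.FreeProbeLawG_of_steinSplit := by
  intro h1 h2 h3 G _ _ _ _ hG r C₀
  obtain ⟨K, δ, C, β₀, hδ, hC, H1⟩ := h1 G hG r C₀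
  obtain ⟨δ', C', β₀', hδ', hC', H3⟩ := h3 G hG r C₀
  refine ⟨max K 0, min δ δ', 2 * C * C' + C', max (max β₀ β₀') 1, lt_min hδ hδ', by positivity, ?_⟩
  intro β hβ μ hμ hi _hii n hn
  have hβ₀ : β₀ ≤ β := le_trans (le_trans (le_max_left _ _) (le_max_left _ _)) hβ
  have hβ₀' : β₀' ≤ β := le_trans (le_trans (le_max_right _ _) (le_max_left _ _)) hβ
  have hβ1 : 1 ≤ β := le_trans (le_max_right _ _) hβ
  have hβ0 : 0 < β := by linarith
  -- the discrepancy `ε = C (1+n)^K β^{-δ}` of the pair law on `C²` test functions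
  set ε : ℝ := C * (1 + (n : ℝ)) ^ K * β ^ (-δ) with hε
  have hε0 : 0 ≤ ε := by
    have : 0 ≤ (1 + (n : ℝ)) ^ K := le_of_lt (Real.rpow_pos_of_pos (by positivity) _)
    have : 0 ≤ β ^ (-δ) := le_of_lt (Real.rpow_pos_of_pos hβ0 _)
    positivity
  have HD := H1 β hβ₀ μ hμ hi n hn
  -- Stein's lemma: smooth-metric closeness `2ε` of the pair law to `γ_B`
  have HS := h2 G hG r β μ hμ n hn ε hε0 (fun F M hM hF hF1 hF2 => HD F M hM hF hF1 hF2)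
  -- the probe covariance from the pair law, `η := 2ε`
  have HP := H3 β hβ₀' μ hμ hi n hn (2 * ε) (by positivity) (fun h hh hh1 hh2 => HS h hh hh1 hh2)
  exact le_trans HP (glue_constants_le hC hC' hβ1)

end Summit.QuantumFields.YangMills.Theorems.SteinGapBootstrap
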